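import Literature.Topology.FourManifolds.SurfaceTimesTorusTube
import Literature.Topology.FourManifolds.ToricBlowupPolar
import HarnessLib

/-!
# The plumbing chart of `F × T²` at a point of the fibre `F × {(1, 1)}`

Topic `Literature/Topology/FourManifolds` (fact seat of the Seiberg–Witten leaf
`Literature.Barriers.SmoothPoincare4.akhmedovPark2010_lemma8_invariants`; block 2 of
Akhmedov–Park's `X₁(m)`, A. Akhmedov, B. D. Park, Invent. Math. 181 (2010), §3: in
`T⁴ = T² × T²` the torus `T² × {y₀}` meets the braided torus `T_β` transversally in two points,
one of which is resolved and the other blown up — both through local models in complex plumbing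
coordinates `(a, b) ∈ ℂ × ℂ` in which the two sheets are `{b = 0}`, `{a = 0}` with PRODUCT tubes,
`DoublePointResolutionNeck.lean`, `BlowUpLineCapTube.lean`).  For the tree's smooth model
`e : X ≃ (F × S¹) × S¹` of `F × T²` with its fibre tube
`e (T (p, v)) = ((p, exp(i arctan v₀)), exp(i arctan v₁))` (`exists_surface_prod_torus_smooth_model`,
`SurfaceTimesTorusTube.lean`) this file builds, from any chart `eF` of `F` with target all of `ℝ²`
and a scale `c > 0`, the **plumbing chart** of `X` at the fibre `F × {(1, 1)}`:

  `Π x = (a, b)`, `a = eF (e x).1.1 ∈ ℝ² ≅ ℂ`, `b = c • (tan ∠(e x).1.2, tan ∠(e x).2) ∈ ℝ² ≅ ℂ`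

(`tan ∠z = Im z/Re z` on the half circle `Re z > 0`), packed into `ℝ⁴` by
`Literature.Topology.FourManifolds.ToricBlowup.fromC2` (real parts in the slots `0, 1`,
imaginary parts in `2, 3` — the convention of the affine charts of `ℂℙ²`).  Everything is proved;
no definitions, no named facts:

* `exists_plumbingChart` — `Π` is a chart of the maximal `C^∞` atlas of `X` with
  `Π.target = univ` (the shape of chart Kervaire–Milnor's connected sum asks for,
  `Literature.Topology.FourManifolds.ConnectedSumData`), source
  `{x | (e x).1.1 ∈ eF.source ∧ Re (e x).1.2 > 0 ∧ Re (e x).2 > 0}`, the displayed formula, an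
  explicit inverse, and — the point of the construction — **the fibre tube is linear in it**:
  `toC2 (Π (T (p, v))) = (eF p, c v)` for `p ∈ eF.source` (`tan (arctan t) = t`), i.e. in the
  coordinates `(a, b)` the sheet `F × {(1,1)}` is `{b = 0}` and its tube is `(a, ρ) ↦ (a, c ρ)`.

## References

* A. Akhmedov, B. D. Park, Invent. Math. 181 (2010) 577–603, §3. [AkhmedovPark2010]
* J. M. Lee, *Introduction to Smooth Manifolds*, 2nd ed. (2013), Prop. 1.17. [LeeSmoothManifolds2013]
-/

noncomputable section

open scoped Manifold ContDiff Topology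
open Set Function
open Literature.Topology.FourManifolds.ToricBlowup

namespace Literature.Topology.FourManifolds

namespace PlumbingChart

/-- The half-circle coordinate `tan ∠z = Im z/Re z` is smooth on `Re z > 0`. [folklore] -/
theorem contMDiffOn_tanAngle :
    ContMDiffOn (𝓡 1) 𝓘(ℝ, ℝ) ∞ (fun z : Circle => (z : ℂ).im / (z : ℂ).re)
      {z : Circle | 0 < (z : ℂ).re} := by
  haveI : Fact (Module.finrank ℝ ℂ = 1 + 1) := finrank_real_complex_fact'
  have hcoe : ContMDiff (𝓡 1) 𝓘(ℝ, ℂ) ∞ (fun z : Circle => (z : ℂ)) := contMDiff_coe_sphere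
  have hre : ContMDiff (𝓡 1) 𝓘(ℝ, ℝ) ∞ fun z : Circle => (z : ℂ).re := Complex.reCLM.contMDiff.comp hcoe
  have him : ContMDiff (𝓡 1) 𝓘(ℝ, ℝ) ∞ fun z : Circle => (z : ℂ).im := Complex.imCLM.contMDiff.comp hcoe
  exact him.contMDiffOn.div₀ hre.contMDiffOn fun z hz => ne_of_gt hz

/-- `ℂ` from its real and imaginary parts is smooth (it is the inverse of `equivRealProdCLM`).
[folklore] -/
theorem contDiff_complex_mk : ContDiff ℝ ∞ fun p : ℝ × ℝ => (⟨p.1, p.2⟩ : ℂ) := by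
  have : (fun p : ℝ × ℝ => (⟨p.1, p.2⟩ : ℂ)) = Complex.equivRealProdCLM.symm := by
    funext p; rfl
  rw [this]
  exact Complex.equivRealProdCLM.symm.contDiff

end PlumbingChart

open PlumbingChart in
/-- **The plumbing chart of the model `X ≅ (F × S¹) × S¹` at the fibre `F × {(1, 1)}`.**  Let
`e : X ≃ (F × S¹) × S¹` be smooth in both directions (the recharted model of
`exists_surface_prod_torus_smooth_model`), `eF` a chart of the maximal atlas of `F` with
`eF.target = univ`, and `c > 0`.  Then there is a chart `Π` of the maximal `C^∞` atlas of `X` with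
target all of `ℝ⁴`, source `{x | (e x).1.1 ∈ eF.source ∧ Re (e x).1.2 > 0 ∧ Re (e x).2 > 0}`,
given by `toC2 (Π x) = (eF (e x).1.1, c • (Im/Re (e x).1.2, Im/Re (e x).2))` (first `ℝ²`-coordinate
read as a complex number), with the explicit inverse below; and the fibre tube of the model,
`e (T (p, v)) = ((p, exp(i arctan v₀)), exp(i arctan v₁))`, is LINEAR in it:
`toC2 (Π (T (p, v))) = (eF p, c v)` for `p ∈ eF.source`. [cite: LeeSmoothManifolds2013, Prop. 1.17] -/
theorem exists_plumbingChart
    {F : Type} [TopologicalSpace F] [ChartedSpace (EuclideanSpace ℝ (Fin 2)) F]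
    [IsManifold (𝓡 2) ∞ F]
    {X : Type} [TopologicalSpace X] [ChartedSpace (EuclideanSpace ℝ (Fin 4)) X]
    [IsManifold (𝓡 4) ∞ X]
    (e : X ≃ₜ (F × Circle) × Circle)
    (he : ContMDiff (𝓡 4) (((𝓡 2).prod (𝓡 1)).prod (𝓡 1)) ∞ e)
    (he' : ContMDiff (((𝓡 2).prod (𝓡 1)).prod (𝓡 1)) (𝓡 4) ∞ e.symm)
    {eF : OpenPartialHomeomorph F (EuclideanSpace ℝ (Fin 2))}
    (heF : eF ∈ IsManifold.maximalAtlas (𝓡 2) ∞ F) (heFt : eF.target = univ) {c : ℝ} (hc : 0 < c) :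
    ∃ P : OpenPartialHomeomorph X (EuclideanSpace ℝ (Fin 4)),
      P ∈ IsManifold.maximalAtlas (𝓡 4) ∞ X ∧ P.target = univ ∧
      P.source = {x | (e x).1.1 ∈ eF.source ∧ 0 < (((e x).1.2 : Circle) : ℂ).re ∧
        0 < (((e x).2 : Circle) : ℂ).re} ∧
      (∀ x, toC2 (P x) = ((⟨eF (e x).1.1 0, eF (e x).1.1 1⟩ : ℂ),
        (⟨c * ((((e x).1.2 : Circle) : ℂ).im / (((e x).1.2 : Circle) : ℂ).re),
          c * ((((e x).2 : Circle) : ℂ).im / (((e x).2 : Circle) : ℂ).re)⟩ : ℂ))) ∧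
      (∀ w : EuclideanSpace ℝ (Fin 4), P.symm w = e.symm
        ((eF.symm ((toC2 w).1.re • EuclideanSpace.single 0 (1 : ℝ) +
            (toC2 w).1.im • EuclideanSpace.single 1 (1 : ℝ)),
          Circle.exp (Real.arctan ((toC2 w).2.re / c))), Circle.exp (Real.arctan ((toC2 w).2.im / c)))) ∧
      (∀ (T : F × EuclideanSpace ℝ (Fin 2) → X),
        (∀ (p : F) (v : EuclideanSpace ℝ (Fin 2)),
          e (T (p, v)) = ((p, Circle.exp (Real.arctan (v 0))), Circle.exp (Real.arctan (v 1)))) →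
        ∀ (p : F) (v : EuclideanSpace ℝ (Fin 2)), p ∈ eF.source →
          T (p, v) ∈ P.source ∧
          toC2 (P (T (p, v))) = ((⟨eF p 0, eF p 1⟩ : ℂ), (⟨c * v 0, c * v 1⟩ : ℂ))) := by
  -- notation
  let ℓ : Circle → ℝ := fun z => (z : ℂ).im / (z : ℂ).re
  let ε : ℝ → Circle := fun t => Circle.exp (Real.arctan t)
  let e₀ : EuclideanSpace ℝ (Fin 2) := EuclideanSpace.single 0 1
  let e₁ : EuclideanSpace ℝ (Fin 2) := EuclideanSpace.single 1 1
  let S : Set X := {x | (e x).1.1 ∈ eF.source ∧ 0 < (((e x).1.2 : Circle) : ℂ).re ∧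
    0 < (((e x).2 : Circle) : ℂ).re}
  let Φ : X → EuclideanSpace ℝ (Fin 4) := fun x => fromC2
    ((⟨eF (e x).1.1 0, eF (e x).1.1 1⟩ : ℂ), (⟨c * ℓ (e x).1.2, c * ℓ (e x).2⟩ : ℂ))
  let Ψ : EuclideanSpace ℝ (Fin 4) → X := fun w => e.symm
    ((eF.symm ((toC2 w).1.re • e₀ + (toC2 w).1.im • e₁), ε ((toC2 w).2.re / c)), ε ((toC2 w).2.im / c))
  have hpack : ∀ a b : ℝ, (a • e₀ + b • e₁) 0 = a ∧ (a • e₀ + b • e₁) 1 = b := fun a b => by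
    constructor <;> simp [e₀, e₁]
  have hpack' : ∀ u : EuclideanSpace ℝ (Fin 2), u 0 • e₀ + u 1 • e₁ = u := fun u => by
    ext i; fin_cases i
    · exact (hpack _ _).1
    · exact (hpack _ _).2
  have hℓε : ∀ t, ℓ (ε t) = t := fun t => im_div_re_circleExp_arctan t
  have hεℓ : ∀ {z : Circle}, 0 < (z : ℂ).re → ε (ℓ z) = z := fun hz => circleExp_arctan_im_div_re hz
  -- the two inverses
  have hΨΦ : ∀ x ∈ S, Ψ (Φ x) = x := by
    intro x hx
    obtain ⟨h₁, h₂, h₃⟩ := hx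
    show e.symm ((eF.symm ((toC2 (Φ x)).1.re • e₀ + (toC2 (Φ x)).1.im • e₁),
      ε ((toC2 (Φ x)).2.re / c)), ε ((toC2 (Φ x)).2.im / c)) = x
    simp only [Φ, toC2_fromC2]
    rw [mul_div_cancel_left₀ _ hc.ne', mul_div_cancel_left₀ _ hc.ne', hpack', eF.left_inv h₁, hεℓ h₂,
      hεℓ h₃]
    exact e.symm_apply_apply x
  have heΨ : ∀ w, e (Ψ w) = ((eF.symm ((toC2 w).1.re • e₀ + (toC2 w).1.im • e₁),
      ε ((toC2 w).2.re / c)), ε ((toC2 w).2.im / c)) := fun w => e.apply_symm_apply _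
  have hΦΨ : ∀ w, Φ (Ψ w) = w := by
    intro w
    apply toC2_injective
    show toC2 (fromC2 _) = toC2 w
    rw [toC2_fromC2, heΨ]
    simp only
    have hr : eF (eF.symm ((toC2 w).1.re • e₀ + (toC2 w).1.im • e₁)) =
        (toC2 w).1.re • e₀ + (toC2 w).1.im • e₁ := eF.right_inv (by rw [heFt]; exact mem_univ _)
    rw [hr, (hpack _ _).1, (hpack _ _).2, hℓε, hℓε, mul_div_cancel₀ _ hc.ne', mul_div_cancel₀ _ hc.ne']
  have hΨS : ∀ w, Ψ w ∈ S := by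
    intro w
    show (e (Ψ w)).1.1 ∈ eF.source ∧ 0 < (((e (Ψ w)).1.2 : Circle) : ℂ).re ∧
      0 < (((e (Ψ w)).2 : Circle) : ℂ).re
    rw [heΨ]
    exact ⟨eF.map_target (by rw [heFt]; exact mem_univ _), re_circleExp_arctan_pos _,
      re_circleExp_arctan_pos _⟩
  -- smoothness
  haveI hC : Fact (Module.finrank ℝ ℂ = 1 + 1) := finrank_real_complex_fact'
  have hSo : IsOpen S := by
    have hc1 : Continuous fun z : Circle => (z : ℂ).re := Complex.continuous_re.comp continuous_subtype_val
    refine ((eF.open_source.preimage (continuous_fst.comp (continuous_fst.comp e.continuous))).inter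
      ((isOpen_lt continuous_const (hc1.comp (continuous_snd.comp (continuous_fst.comp e.continuous)))).inter
      (isOpen_lt continuous_const (hc1.comp (continuous_snd.comp e.continuous)))))
  have hq : ContMDiff (𝓡 4) (𝓡 2) ∞ fun x => (e x).1.1 := contMDiff_fst.comp (contMDiff_fst.comp he)
  have hz₁ : ContMDiff (𝓡 4) (𝓡 1) ∞ fun x => ((e x).1.2 : Circle) := contMDiff_snd.comp (contMDiff_fst.comp he)
  have hz₂ : ContMDiff (𝓡 4) (𝓡 1) ∞ fun x => ((e x).2 : Circle) := contMDiff_snd.comp he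
  have heFsm : ContMDiffOn (𝓡 4) 𝓘(ℝ, EuclideanSpace ℝ (Fin 2)) ∞ (fun x => eF (e x).1.1) S :=
    (contMDiffOn_of_mem_maximalAtlas heF).comp hq.contMDiffOn fun x hx => hx.1
  have hproj : ∀ i : Fin 2, ContMDiff 𝓘(ℝ, EuclideanSpace ℝ (Fin 2)) 𝓘(ℝ, ℝ) ∞
      (fun v : EuclideanSpace ℝ (Fin 2) => v i) :=
    fun i => (EuclideanSpace.proj (𝕜 := ℝ) (ι := Fin 2) i).contMDiff
  have hℓ₁ : ContMDiffOn (𝓡 4) 𝓘(ℝ, ℝ) ∞ (fun x => ℓ (e x).1.2) S :=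
    contMDiffOn_tanAngle.comp hz₁.contMDiffOn fun x hx => hx.2.1
  have hℓ₂ : ContMDiffOn (𝓡 4) 𝓘(ℝ, ℝ) ∞ (fun x => ℓ (e x).2) S :=
    contMDiffOn_tanAngle.comp hz₂.contMDiffOn fun x hx => hx.2.2
  have hΦsm : ContMDiffOn (𝓡 4) 𝓘(ℝ, EuclideanSpace ℝ (Fin 4)) ∞ Φ S := by
    have ha : ContMDiffOn (𝓡 4) 𝓘(ℝ, ℂ) ∞ (fun x => (⟨eF (e x).1.1 0, eF (e x).1.1 1⟩ : ℂ)) S :=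
      contDiff_complex_mk.contMDiff.comp_contMDiffOn
        (((hproj 0).comp_contMDiffOn heFsm).prodMk_space ((hproj 1).comp_contMDiffOn heFsm))
    have hb : ContMDiffOn (𝓡 4) 𝓘(ℝ, ℂ) ∞ (fun x => (⟨c * ℓ (e x).1.2, c * ℓ (e x).2⟩ : ℂ)) S :=
      contDiff_complex_mk.contMDiff.comp_contMDiffOn
        ((contMDiffOn_const.mul hℓ₁).prodMk_space (contMDiffOn_const.mul hℓ₂))
    exact contDiff_fromC2.contMDiff.comp_contMDiffOn (ha.prodMk_space hb)
  have hΨsm : ContMDiff 𝓘(ℝ, EuclideanSpace ℝ (Fin 4)) (𝓡 4) ∞ Ψ := by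
    have h1 : ContMDiff 𝓘(ℝ, EuclideanSpace ℝ (Fin 4)) 𝓘(ℝ, ℂ) ∞ fun w => (toC2 w).1 :=
      (contDiff_fst.comp contDiff_toC2).contMDiff
    have h2 : ContMDiff 𝓘(ℝ, EuclideanSpace ℝ (Fin 4)) 𝓘(ℝ, ℂ) ∞ fun w => (toC2 w).2 :=
      (contDiff_snd.comp contDiff_toC2).contMDiff
    have hre : ContMDiff 𝓘(ℝ, ℂ) 𝓘(ℝ, ℝ) ∞ fun z : ℂ => z.re := Complex.reCLM.contMDiff
    have him : ContMDiff 𝓘(ℝ, ℂ) 𝓘(ℝ, ℝ) ∞ fun z : ℂ => z.im := Complex.imCLM.contMDiff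
    have hu : ContMDiff 𝓘(ℝ, EuclideanSpace ℝ (Fin 4)) 𝓘(ℝ, EuclideanSpace ℝ (Fin 2)) ∞
        fun w => (toC2 w).1.re • e₀ + (toC2 w).1.im • e₁ :=
      ((hre.comp h1).smul contMDiff_const).add ((him.comp h1).smul contMDiff_const)
    have hF : ContMDiff 𝓘(ℝ, EuclideanSpace ℝ (Fin 4)) (𝓡 2) ∞
        fun w => eF.symm ((toC2 w).1.re • e₀ + (toC2 w).1.im • e₁) := by
      have hs := contMDiffOn_symm_of_mem_maximalAtlas heF
      rw [heFt, contMDiffOn_univ] at hs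
      exact hs.comp hu
    have hε : ContMDiff 𝓘(ℝ, ℝ) (𝓡 1) ∞ ε := contMDiff_circleExp_arctan
    have hc₁ : ContMDiff 𝓘(ℝ, EuclideanSpace ℝ (Fin 4)) (𝓡 1) ∞ fun w => ε ((toC2 w).2.re / c) :=
      hε.comp ((hre.comp h2).div_const c)
    have hc₂ : ContMDiff 𝓘(ℝ, EuclideanSpace ℝ (Fin 4)) (𝓡 1) ∞ fun w => ε ((toC2 w).2.im / c) :=
      hε.comp ((him.comp h2).div_const c)
    exact he'.comp ((hF.prodMk hc₁).prodMk hc₂)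
  -- the chart
  let P : OpenPartialHomeomorph X (EuclideanSpace ℝ (Fin 4)) :=
    { toFun := Φ
      invFun := Ψ
      source := S
      target := univ
      map_source' := fun _ _ => mem_univ _
      map_target' := fun w _ => hΨS w
      left_inv' := fun x hx => hΨΦ x hx
      right_inv' := fun w _ => hΦΨ w
      open_source := hSo
      open_target := isOpen_univ
      continuousOn_toFun := hΦsm.continuousOn
      continuousOn_invFun := hΨsm.continuous.continuousOn }
  have hP : P ∈ IsManifold.maximalAtlas (𝓡 4) ∞ X :=
    P.mem_maximalAtlas_of_contMDiffOn hΦsm hΨsm.contMDiffOn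
  refine ⟨P, hP, rfl, rfl, fun x => toC2_fromC2 _, fun w => rfl, ?_⟩
  -- the fibre tube is linear in `Π`
  intro T hT p v hp
  have hep : e (T (p, v)) = ((p, ε (v 0)), ε (v 1)) := hT p v
  refine ⟨?_, ?_⟩
  · show (e (T (p, v))).1.1 ∈ eF.source ∧ 0 < (((e (T (p, v))).1.2 : Circle) : ℂ).re ∧
      0 < (((e (T (p, v))).2 : Circle) : ℂ).re
    rw [hep]
    exact ⟨hp, re_circleExp_arctan_pos _, re_circleExp_arctan_pos _⟩
  · show toC2 (fromC2 _) = _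
    rw [toC2_fromC2, hep]
    simp only [hℓε]

end Literature.Topology.FourManifolds
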